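/-
Copyright: the b2b-balaban T⁴-continuum CRUX team, row NE7b OWNER lineage `t4-ne7b-p1` (gen 148). Project licence.
-/
import Summits.QuantumFields.BalabanUV.T4Continuum.Spine.NE7b.SupWeightedClassMapOrderThree
import Summits.QuantumFields.BalabanUV.T4Continuum.Spine.NE7b.SupWeightedKernelLetterTransportTwo

/-!
# ONE FULL STEP OF THE WEIGHTED CLASS MAP AT ORDER THREE IN THE SECOND- AND THIRD-INDEX ROLES — FLUCTUATION THEN RESCALING
# (SCOPING-d19 §D (1); file (776)).  (749) packaged the fluctuation step at order 3 in all three roles of the OUTPUT third derivative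
# `T(ψ)` of `W⁺(ψ) = −log∫e^{−U(·+ψ)}dμ_{AAᵀ}` (slot `x`: first index, letter `k3rϑ`; slot `y`: second index, letter `k3mϑ`; slot `v`: third
# index, letter `k3cϑ`); (769) composed slot `x` with the first-index transport (766) §3.  The class iterates on the COARSE lattice: the next
# input is `W⁺∘A`, `A = t • J_β`, third-derivative majorant `K3′ = |t|³Σ_{fibres}|T(ψ)|` ((433) §5), and (768) transports the second- and
# third-index full-graph letters through `β` by exact power counting times `M³` (`ϑc(βx,βx′) ≤ M·ϑ(x,x′)`).  THIS FILE composes (749)'s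
# slots `y` and `v` with (768): the next input's second-∕third-index letters of `K3′` IN THE SLOT SHAPES, `≤ |t|³·n·M³·B_y` ∕ `·B_v` — THE
# LOOP CLOSES AT ORDER 3 IN EVERY ROLE (row NE7b, node U5c; (749), (768), (747) BY NAME; [folklore]; generator `records/gen_steps.py`).

Cell `pub-balaban`, sub-cell `t4`, spine estimate NE7b (`T4WeightBudget.RelWeightBound`; the cell's OWN estimate — NOT PRINTED in
[Bałaban 1983–89], NOT PROVED).  Crux-route work under `Spine/NE7b/` by the row OWNER (`t4-ne7b-p1` gen 148, file (776)) under FREEZE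
(0)'s crux-prover clause; NOTHING of Bałaban's is named as a Lean object, valued or asserted; no `T4Continuum/Support` leaf typed; no
`def`, no notation (`T(ψ)`, `K3′`, `B_y`, `B_v` WRITTEN OUT as printed by (749)); zero `sorry`.  Imports (BY NAME): (749)
`…SupWeightedClassMapOrderThree`, (768) `…SupWeightedKernelLetterTransportTwo` ((747) `letter_nonneg₂` through (749)).

WHAT IS PROVED ([folklore]): **`classmap_three_step_y`**, **`classmap_three_step_v`**; toy.

HONEST (what this is NOT).  The order-3 loop of the two remaining letters; the identification of `t³Σ_{fibres}T` with the rescaled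
action's third derivative is (433)'s (met BY SHAPE); the letter VALUES grow per step (`× |t|³·n·M³` + increments) — (432)–(436) NOT booked;
finite-torus Gaussian measure `μ_{AAᵀ}` with the road's regularisation; scalar skeleton ((A3), NC-NE7b-α UNRULED); nothing of Bałaban's
asserted.  BY-NAME EFFECT ON THE WALL: NONE.  NE7b NOT PRINTED ∕ NOT PROVED; spine PROVED 0∕9; rung (B)+1 — the programme's measures
remain FINITE-torus statements; NOT the mass gap, NOT Clay.  HONEST DEPENDENCY: continuum YM on T⁴ ⇐ BetaPertH ∧ nine spine estimates
(0∕9 proved); BetaPertH ⇐ (D1) ∧ (D4) ∧ CAP+tail; G-an2-4 gates asym, D1 and NE2∕3∕4.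
-/

set_option autoImplicit false
set_option maxSynthPendingDepth 3

noncomputable section

namespace Summit.QuantumFields.BalabanUV.T4Continuum.NE7b.SupWeightedClassMapOrderThreeStepRoles

open MeasureTheory ProbabilityTheory Finset Real Matrix
open scoped BigOperators Matrix
open SupWeightedClassMapOrderThree (classmap_three_y classmap_three_v)
open SupWeightedKernelLetterTransportTwo (weighted_coarse_k3_letter_le_second weighted_coarse_k3_letter_le_third)
open SupWeightedProfileDischarge (letter_nonneg₂)

variable {ι κ : Type} [Fintype ι] [DecidableEq ι] [Fintype κ] [DecidableEq κ]
variable {U : EuclideanSpace ℝ ι → ℝ} {U' : EuclideanSpace ℝ ι → EuclideanSpace ℝ ι →L[ℝ] ℝ}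
  {U'' : EuclideanSpace ℝ ι → EuclideanSpace ℝ ι →L[ℝ] EuclideanSpace ℝ ι →L[ℝ] ℝ}
  {U₃ : EuclideanSpace ℝ ι → EuclideanSpace ℝ ι →L[ℝ] EuclideanSpace ℝ ι →L[ℝ] EuclideanSpace ℝ ι →L[ℝ] ℝ} {Hk : ι → ι → ℝ} {K3 : ι → ι → ι → ℝ}
  {A : Matrix ι κ ℝ} {D : κ → κ → ℝ} {γop κ₀ κ₁ κ₂ κ₃ a τ δ θp lam lamA αr αc hr γ dθ dθ' αθ βθ : ℝ} {θ : κ → κ → ℝ}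
  {σ σA : ι → κ → ℝ} {ρ ϑ ϑ₂ : ι → ι → ℝ} {αθc αg1m αg2m αg1c αrσ αcσ hrϑ hcϑ k3rϑ k3mϑ k3cϑ Sϑ2 : ℝ}

set_option maxHeartbeats 800000 in
/-- **ONE FULL STEP OF THE WEIGHTED CLASS AT ORDER 3, SLOT `y` (second `K3`-index, letter `k3mϑ`)**: fluctuation ((749) `classmap_three_y`)
then rescaling ((768) `weighted_coarse_k3_letter_le_second`).  With `K3⁺(x,y,v) := |T(ψ)[e_v,e_x,e_y]|` (the output majorant, fine lattice), the block map `β`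
(fibres of `≤ n` sites), normalisation `t` and a coarse weight with `ϑc(βx,βx′) ≤ M·ϑ(x,x′)`, the coarse majorant `K3′ := |t|³Σ_{fibres}K3⁺` has
the next step's INPUT second-index letter in the SLOT shape `≤ |t|³·n·M³·B_y`, `B_y` = (749)'s bound — THE LOOP CLOSES AT ORDER 3 IN
THE SECOND-INDEX ROLE. [folklore] -/
theorem classmap_three_step_y [Nonempty ι] [Nonempty κ] (hΓop : (γop • (1 : Matrix ι ι ℝ) - A * Aᵀ).PosSemidef) (Y : Finset ι)
    (hUd : ∀ φ : EuclideanSpace ℝ ι, HasFDerivAt U (U' φ) φ) (hU'd : ∀ φ : EuclideanSpace ℝ ι, HasFDerivAt U' (U'' φ) φ)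
    (hU''d : ∀ φ : EuclideanSpace ℝ ι, HasFDerivAt U'' (U₃ φ) φ) (hU₃c : Continuous U₃) (hκ₀ : 0 ≤ κ₀) (hκ₁ : 0 ≤ κ₁) (ha : 0 ≤ a) (hκ₂ : 0 ≤ κ₂)
    (hκ₃ : 0 ≤ κ₃) (hτ : 0 < τ) (hδ : 0 < δ) (hθ0 : 0 < θp) (hθ1 : θp < 1) (hκθ : (2 * κ₀ * (1 + τ) + 4 * δ) * γop ≤ θp)
    (hκθw : 2 * κ₀ * (1 + τ) * γop + 4 * δ ≤ θp) (hstab : ∀ φ : EuclideanSpace ℝ ι, -(κ₀ * ∑ x ∈ Y, φ x ^ 2) ≤ U φ)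
    (hU'b : ∀ φ : EuclideanSpace ℝ ι, ‖U' φ‖ ≤ κ₁ * (a + ∑ x ∈ Y, φ x ^ 2)) (hU''b : ∀ φ : EuclideanSpace ℝ ι, ‖U'' φ‖ ≤ κ₂)
    (hU₃b : ∀ φ : EuclideanSpace ℝ ι, ‖U₃ φ‖ ≤ κ₃) (hlam : 0 ≤ lam)
    (hUsec : ∀ s : ℝ, 0 ≤ s → s ≤ 1 → ∀ a b : EuclideanSpace ℝ ι, U ((1 - s) • a + s • b) - lam / 2 * (s * (1 - s)) * ∑ i, (a i - b i) ^ 2 ≤ (1 - s)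
      * U a + s * U b) (hρg : lam * γop < 1)
    (hHk : ∀ (φ : EuclideanSpace ℝ ι) (x z : ι), |U'' φ (EuclideanSpace.single z (1 : ℝ)) (EuclideanSpace.single x (1 : ℝ))| ≤ Hk x z)
    (hHk0 : ∀ v u, 0 ≤ Hk v u)
    (hK3 : ∀ (φ : EuclideanSpace ℝ ι) (u x y : ι), |U₃ φ (EuclideanSpace.single u (1 : ℝ)) (EuclideanSpace.single x (1 : ℝ))
      (EuclideanSpace.single y (1 : ℝ))| ≤ K3 x y u) (hhr : ∀ v, ∑ u, Hk v u ≤ hr) (ψ : EuclideanSpace ℝ ι) (hαr : ∀ u, ∑ w, |A u w| ≤ αr)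
    (hαc : ∀ w, ∑ u, |A u w| ≤ αc) (hlamA : ∀ x : κ, ∑ u, ∑ v, |A u x| * |A v x| * Hk v u ≤ lamA) (hlamA1 : lamA < 1)
    (hγ : αc * hr * αr / (1 - lamA) ≤ γ) (hγ1 : γ < 1) (hD : ∀ x y, 0 ≤ D x y)
    (hDC : ∀ x y, (if x = y then (1 : ℝ) else 0) + ∑ z, D x z * ((if y = z then 0 else ∑ u, ∑ v, |A u y| * |A v z| * Hk v u) / (1 - lamA)) ≤ D x y)
    (hθw1 : ∀ z w, 1 ≤ θ z w) (hDr : ∀ z, ∑ w, D z w * θ z w ≤ dθ) (hdθ : 0 ≤ dθ) (hDc : ∀ w, ∑ z, D z w * θ z w ≤ dθ') (hdθ' : 0 ≤ dθ')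
    (hσ0 : ∀ x w, 0 ≤ σ x w) (hσθ : ∀ x z w, σ x w ≤ σ x z * θ z w) (hρ1 : ∀ x y, 1 ≤ ρ x y) (hρsymm : ∀ x y, ρ x y = ρ y x)
    (hρmul : ∀ x y z, ρ x z ≤ ρ x y * ρ y z) (hρσ : ∀ x y w, ρ x y ^ 8 ≤ σ x w * σ y w) (hϑ1 : ∀ x y, 1 ≤ ϑ x y) (hϑsymm : ∀ x y, ϑ x y = ϑ y x)
    (hϑmul : ∀ x y z, ϑ x z ≤ ϑ x y * ϑ y z) (hϑ2 : ∀ x y, ϑ x y * ϑ x y ≤ ϑ₂ x y) (hϑ₂symm : ∀ x y, ϑ₂ x y = ϑ₂ y x)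
    (hϑσ : ∀ x y w, ϑ x y * ϑ x y ≤ σ x w * σ y w) (hS2 : ∀ v, ∑ x, ϑ v x * ϑ v x / ρ v x ≤ Sϑ2) (hσA0 : ∀ u z', 0 ≤ σA u z')
    (hσϑ₂ : ∀ v u z', σ v z' ≤ ϑ₂ v u * σA u z') (hAr : ∀ u, ∑ z', |A u z'| * σA u z' ≤ αrσ) (hαrσ : 0 ≤ αrσ)
    (hAc : ∀ z', ∑ u, |A u z'| * σA u z' ≤ αcσ) (hαcσ : 0 ≤ αcσ) (hhrw : ∀ a, ∑ b, ϑ₂ a b * Hk a b ≤ hrϑ) (hhc : ∀ a, ∑ b, ϑ₂ a b * Hk b a ≤ hcϑ)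
    (hk3m : ∀ y, ∑ x, ∑ v, K3 x y v * (ϑ₂ y x * ϑ₂ y v * ϑ₂ x v) ≤ k3mϑ) (hk3c : ∀ v, ∑ y, ∑ z, K3 y z v * (ϑ₂ v y * ϑ₂ v z * ϑ₂ y z) ≤ k3cϑ)
    (hαθ : hrϑ * αrσ ≤ αθ) (hαβ : αθ ≤ βθ) (hαθc : hcϑ * αcσ ≤ αθc) (hαg2m : k3mϑ * αrσ ≤ αg2m) (hαg1c : k3cϑ * αcσ ≤ αg1c)
    {ι' : Type} [Fintype ι'] [DecidableEq ι'] (β : ι → ι') {n : ℕ} (hfib : ∀ y, (Finset.univ.filter fun x => β x = y).card ≤ n)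
    {ϑc : ι' → ι' → ℝ} {M : ℝ} (hM : 0 ≤ M) (hϑc0 : ∀ y y', 0 ≤ ϑc y y') (hϑc : ∀ x x', ϑc (β x) (β x') ≤ M * ϑ x x') (t : ℝ) (y₁ : ι') :
    ∑ y₂, ∑ y₃,
        (|t| ^ 3 * ∑ x ∈ Finset.univ.filter (fun x => β x = y₂), ∑ y ∈ Finset.univ.filter (fun y => β y = y₁), ∑ v ∈ Finset.univ.filter
          (fun v => β v = y₃),
          |(((∫ ω : EuclideanSpace ℝ ι, exp (-U (ω + ψ)) ∂(multivariateGaussian 0 (A * Aᵀ)))⁻¹ •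
              (∫ ω : EuclideanSpace ℝ ι,
                (exp (-U (ω + ψ)) •
                  (U₃ (ω + ψ) -
                    (((ContinuousLinearMap.smulRightL ℝ (EuclideanSpace ℝ ι) (EuclideanSpace ℝ ι →L[ℝ] ℝ)) (U' (ω + ψ))).comp (U'' (ω + ψ)) +
                      (((ContinuousLinearMap.smulRightL ℝ (EuclideanSpace ℝ ι) (EuclideanSpace ℝ ι →L[ℝ] ℝ))).comp (U'' (ω + ψ))).flip (U' (ω + ψ))))
                  + (exp (-U (ω + ψ)) • -U' (ω + ψ)).smulRight (U'' (ω + ψ) - (U' (ω + ψ)).smulRight (U' (ω + ψ))))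
                ∂(multivariateGaussian 0 (A * Aᵀ))) +
              ((-((∫ ω : EuclideanSpace ℝ ι, exp (-U (ω + ψ)) ∂(multivariateGaussian 0 (A * Aᵀ))) ^ 2)⁻¹) •
                -(∫ ω : EuclideanSpace ℝ ι, exp (-U (ω + ψ)) • U' (ω + ψ) ∂(multivariateGaussian 0 (A * Aᵀ)))).smulRight
              (∫ ω : EuclideanSpace ℝ ι, exp (-U (ω + ψ)) • (U'' (ω + ψ) - (U' (ω + ψ)).smulRight (U' (ω + ψ))) ∂(multivariateGaussian 0 (A * Aᵀ))))
            +
            (((ContinuousLinearMap.smulRightL ℝ (EuclideanSpace ℝ ι) (EuclideanSpace ℝ ι →L[ℝ] ℝ))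
                (((∫ ω : EuclideanSpace ℝ ι, exp (-U (ω + ψ)) ∂(multivariateGaussian 0 (A * Aᵀ))) ^ 2)⁻¹ •
                  (∫ ω : EuclideanSpace ℝ ι, exp (-U (ω + ψ)) • U' (ω + ψ) ∂(multivariateGaussian 0 (A * Aᵀ))))).comp
              (∫ ω : EuclideanSpace ℝ ι, exp (-U (ω + ψ)) • (U'' (ω + ψ) - (U' (ω + ψ)).smulRight (U' (ω + ψ))) ∂(multivariateGaussian 0 (A * Aᵀ)))
              +
              (((ContinuousLinearMap.smulRightL ℝ (EuclideanSpace ℝ ι) (EuclideanSpace ℝ ι →L[ℝ] ℝ))).comp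
                (((∫ ω : EuclideanSpace ℝ ι, exp (-U (ω + ψ)) ∂(multivariateGaussian 0 (A * Aᵀ))) ^ 2)⁻¹ •
                  (∫ ω : EuclideanSpace ℝ ι, exp (-U (ω + ψ)) • (U'' (ω + ψ) - (U' (ω + ψ)).smulRight (U' (ω + ψ)))
                    ∂(multivariateGaussian 0 (A * Aᵀ))) +
                  ((-2 / (∫ ω : EuclideanSpace ℝ ι, exp (-U (ω + ψ)) ∂(multivariateGaussian 0 (A * Aᵀ))) ^ 3) •
                    -(∫ ω : EuclideanSpace ℝ ι, exp (-U (ω + ψ)) • U' (ω + ψ) ∂(multivariateGaussian 0 (A * Aᵀ)))).smulRight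
                  (∫ ω : EuclideanSpace ℝ ι, exp (-U (ω + ψ)) • U' (ω + ψ) ∂(multivariateGaussian 0 (A * Aᵀ))))).flip
              (∫ ω : EuclideanSpace ℝ ι, exp (-U (ω + ψ)) • U' (ω + ψ) ∂(multivariateGaussian 0 (A * Aᵀ))))) (EuclideanSpace.single v (1 : ℝ))
          (EuclideanSpace.single x (1 : ℝ)) (EuclideanSpace.single y (1 : ℝ))|) * (ϑc y₁ y₂ * ϑc y₁ y₃ * ϑc y₂ y₃) ≤
      |t| ^ 3 * n * M ^ 3 *
          (k3mϑ + (dθ * αg2m * (dθ' * αθc) / (1 - lamA) + dθ * αθ * (dθ' * αg1c) / (1 - lamA) + dθ * αg2m * (dθ' * αθc) / (1 - lamA)) + 4 *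
            Real.sqrt (5 * (κ₂ ^ 4 * γop ^ 2) / (1 - lam * γop) ^ 2 * (αθ * dθ * (βθ * dθ') / (1 - lamA))) * Sϑ2 ^ 2) := by
  obtain ⟨v₀⟩ : Nonempty ι := inferInstance
  have hϑ0 : ∀ a b, 0 ≤ ϑ a b := fun a b => zero_le_one.trans (hϑ1 a b)
  refine weighted_coarse_k3_letter_le_second β hfib _ (fun _ _ _ => abs_nonneg _) hM hϑ0 hϑc0 hϑc ?_
      (fun y => classmap_three_y hΓop Y hUd hU'd hU''d hU₃c hκ₀ hκ₁ ha hκ₂ hκ₃ hτ hδ hθ0 hθ1 hκθ hκθw hstab hU'b hU''b hU₃b hlam hUsec hρg hHk hHk0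
        hK3 hhr ψ hαr hαc hlamA hlamA1 hγ hγ1 hD hDC hθw1 hDr hdθ hDc hdθ' hσ0 hσθ hρ1 hρsymm hρmul hρσ hϑ1 hϑsymm hϑmul hϑ2 hϑ₂symm hϑσ hS2 hσA0
        hσϑ₂ hAr hαrσ hAc hαcσ hhrw hhc hk3m hk3c hαθ hαβ hαθc hαg2m hαg1c y) t y₁
  exact letter_nonneg₂ (fun x v => mul_nonneg (abs_nonneg _) (mul_nonneg (mul_nonneg (hϑ0 v₀ x) (hϑ0 v₀ v)) (hϑ0 x v)))
      (classmap_three_y hΓop Y hUd hU'd hU''d hU₃c hκ₀ hκ₁ ha hκ₂ hκ₃ hτ hδ hθ0 hθ1 hκθ hκθw hstab hU'b hU''b hU₃b hlam hUsec hρg hHk hHk0 hK3 hhr ψ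
        hαr hαc hlamA hlamA1 hγ hγ1 hD hDC hθw1 hDr hdθ hDc hdθ' hσ0 hσθ hρ1 hρsymm hρmul hρσ hϑ1 hϑsymm hϑmul hϑ2 hϑ₂symm hϑσ hS2 hσA0 hσϑ₂ hAr
        hαrσ hAc hαcσ hhrw hhc hk3m hk3c hαθ hαβ hαθc hαg2m hαg1c v₀)

set_option maxHeartbeats 800000 in
/-- **ONE FULL STEP OF THE WEIGHTED CLASS AT ORDER 3, SLOT `v` (third `K3`-index, letter `k3cϑ`)**: fluctuation ((749) `classmap_three_v`)
then rescaling ((768) `weighted_coarse_k3_letter_le_third`).  With `K3⁺(x,y,v) := |T(ψ)[e_v,e_x,e_y]|` (the output majorant, fine lattice), the block map `β`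
(fibres of `≤ n` sites), normalisation `t` and a coarse weight with `ϑc(βx,βx′) ≤ M·ϑ(x,x′)`, the coarse majorant `K3′ := |t|³Σ_{fibres}K3⁺` has
the next step's INPUT third-index letter in the SLOT shape `≤ |t|³·n·M³·B_v`, `B_v` = (749)'s bound — THE LOOP CLOSES AT ORDER 3 IN
THE THIRD-INDEX ROLE. [folklore] -/
theorem classmap_three_step_v [Nonempty ι] [Nonempty κ] (hΓop : (γop • (1 : Matrix ι ι ℝ) - A * Aᵀ).PosSemidef) (Y : Finset ι)
    (hUd : ∀ φ : EuclideanSpace ℝ ι, HasFDerivAt U (U' φ) φ) (hU'd : ∀ φ : EuclideanSpace ℝ ι, HasFDerivAt U' (U'' φ) φ)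
    (hU''d : ∀ φ : EuclideanSpace ℝ ι, HasFDerivAt U'' (U₃ φ) φ) (hU₃c : Continuous U₃) (hκ₀ : 0 ≤ κ₀) (hκ₁ : 0 ≤ κ₁) (ha : 0 ≤ a) (hκ₂ : 0 ≤ κ₂)
    (hκ₃ : 0 ≤ κ₃) (hτ : 0 < τ) (hδ : 0 < δ) (hθ0 : 0 < θp) (hθ1 : θp < 1) (hκθ : (2 * κ₀ * (1 + τ) + 4 * δ) * γop ≤ θp)
    (hκθw : 2 * κ₀ * (1 + τ) * γop + 4 * δ ≤ θp) (hstab : ∀ φ : EuclideanSpace ℝ ι, -(κ₀ * ∑ x ∈ Y, φ x ^ 2) ≤ U φ)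
    (hU'b : ∀ φ : EuclideanSpace ℝ ι, ‖U' φ‖ ≤ κ₁ * (a + ∑ x ∈ Y, φ x ^ 2)) (hU''b : ∀ φ : EuclideanSpace ℝ ι, ‖U'' φ‖ ≤ κ₂)
    (hU₃b : ∀ φ : EuclideanSpace ℝ ι, ‖U₃ φ‖ ≤ κ₃) (hlam : 0 ≤ lam)
    (hUsec : ∀ s : ℝ, 0 ≤ s → s ≤ 1 → ∀ a b : EuclideanSpace ℝ ι, U ((1 - s) • a + s • b) - lam / 2 * (s * (1 - s)) * ∑ i, (a i - b i) ^ 2 ≤ (1 - s)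
      * U a + s * U b) (hρg : lam * γop < 1)
    (hHk : ∀ (φ : EuclideanSpace ℝ ι) (x z : ι), |U'' φ (EuclideanSpace.single z (1 : ℝ)) (EuclideanSpace.single x (1 : ℝ))| ≤ Hk x z)
    (hHk0 : ∀ v u, 0 ≤ Hk v u)
    (hK3 : ∀ (φ : EuclideanSpace ℝ ι) (u x y : ι), |U₃ φ (EuclideanSpace.single u (1 : ℝ)) (EuclideanSpace.single x (1 : ℝ))
      (EuclideanSpace.single y (1 : ℝ))| ≤ K3 x y u) (hhr : ∀ v, ∑ u, Hk v u ≤ hr) (ψ : EuclideanSpace ℝ ι) (hαr : ∀ u, ∑ w, |A u w| ≤ αr)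
    (hαc : ∀ w, ∑ u, |A u w| ≤ αc) (hlamA : ∀ x : κ, ∑ u, ∑ v, |A u x| * |A v x| * Hk v u ≤ lamA) (hlamA1 : lamA < 1)
    (hγ : αc * hr * αr / (1 - lamA) ≤ γ) (hγ1 : γ < 1) (hD : ∀ x y, 0 ≤ D x y)
    (hDC : ∀ x y, (if x = y then (1 : ℝ) else 0) + ∑ z, D x z * ((if y = z then 0 else ∑ u, ∑ v, |A u y| * |A v z| * Hk v u) / (1 - lamA)) ≤ D x y)
    (hθw1 : ∀ z w, 1 ≤ θ z w) (hDr : ∀ z, ∑ w, D z w * θ z w ≤ dθ) (hdθ : 0 ≤ dθ) (hDc : ∀ w, ∑ z, D z w * θ z w ≤ dθ') (hdθ' : 0 ≤ dθ')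
    (hσ0 : ∀ x w, 0 ≤ σ x w) (hσθ : ∀ x z w, σ x w ≤ σ x z * θ z w) (hρ1 : ∀ x y, 1 ≤ ρ x y) (hρsymm : ∀ x y, ρ x y = ρ y x)
    (hρmul : ∀ x y z, ρ x z ≤ ρ x y * ρ y z) (hρσ : ∀ x y w, ρ x y ^ 8 ≤ σ x w * σ y w) (hϑ1 : ∀ x y, 1 ≤ ϑ x y) (hϑsymm : ∀ x y, ϑ x y = ϑ y x)
    (hϑmul : ∀ x y z, ϑ x z ≤ ϑ x y * ϑ y z) (hϑ2 : ∀ x y, ϑ x y * ϑ x y ≤ ϑ₂ x y) (hϑ₂symm : ∀ x y, ϑ₂ x y = ϑ₂ y x)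
    (hϑσ : ∀ x y w, ϑ x y * ϑ x y ≤ σ x w * σ y w) (hS2 : ∀ v, ∑ x, ϑ v x * ϑ v x / ρ v x ≤ Sϑ2) (hσA0 : ∀ u z', 0 ≤ σA u z')
    (hσϑ₂ : ∀ v u z', σ v z' ≤ ϑ₂ v u * σA u z') (hAr : ∀ u, ∑ z', |A u z'| * σA u z' ≤ αrσ) (hαrσ : 0 ≤ αrσ)
    (hAc : ∀ z', ∑ u, |A u z'| * σA u z' ≤ αcσ) (hαcσ : 0 ≤ αcσ) (hhrw : ∀ a, ∑ b, ϑ₂ a b * Hk a b ≤ hrϑ) (hhc : ∀ a, ∑ b, ϑ₂ a b * Hk b a ≤ hcϑ)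
    (hk3r : ∀ x, ∑ y, ∑ v, K3 x y v * (ϑ₂ x y * ϑ₂ x v * ϑ₂ y v) ≤ k3rϑ) (hk3c : ∀ v, ∑ y, ∑ z, K3 y z v * (ϑ₂ v y * ϑ₂ v z * ϑ₂ y z) ≤ k3cϑ)
    (hαθ : hrϑ * αrσ ≤ αθ) (hαβ : αθ ≤ βθ) (hαθc : hcϑ * αcσ ≤ αθc) (hαg1m : k3rϑ * αrσ ≤ αg1m) (hαg1c : k3cϑ * αcσ ≤ αg1c)
    {ι' : Type} [Fintype ι'] [DecidableEq ι'] (β : ι → ι') {n : ℕ} (hfib : ∀ y, (Finset.univ.filter fun x => β x = y).card ≤ n)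
    {ϑc : ι' → ι' → ℝ} {M : ℝ} (hM : 0 ≤ M) (hϑc0 : ∀ y y', 0 ≤ ϑc y y') (hϑc : ∀ x x', ϑc (β x) (β x') ≤ M * ϑ x x') (t : ℝ) (y₁ : ι') :
    ∑ y₂, ∑ y₃,
        (|t| ^ 3 * ∑ y ∈ Finset.univ.filter (fun y => β y = y₂), ∑ z ∈ Finset.univ.filter (fun z => β z = y₃), ∑ v ∈ Finset.univ.filter
          (fun v => β v = y₁),
          |(((∫ ω : EuclideanSpace ℝ ι, exp (-U (ω + ψ)) ∂(multivariateGaussian 0 (A * Aᵀ)))⁻¹ •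
              (∫ ω : EuclideanSpace ℝ ι,
                (exp (-U (ω + ψ)) •
                  (U₃ (ω + ψ) -
                    (((ContinuousLinearMap.smulRightL ℝ (EuclideanSpace ℝ ι) (EuclideanSpace ℝ ι →L[ℝ] ℝ)) (U' (ω + ψ))).comp (U'' (ω + ψ)) +
                      (((ContinuousLinearMap.smulRightL ℝ (EuclideanSpace ℝ ι) (EuclideanSpace ℝ ι →L[ℝ] ℝ))).comp (U'' (ω + ψ))).flip (U' (ω + ψ))))
                  + (exp (-U (ω + ψ)) • -U' (ω + ψ)).smulRight (U'' (ω + ψ) - (U' (ω + ψ)).smulRight (U' (ω + ψ))))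
                ∂(multivariateGaussian 0 (A * Aᵀ))) +
              ((-((∫ ω : EuclideanSpace ℝ ι, exp (-U (ω + ψ)) ∂(multivariateGaussian 0 (A * Aᵀ))) ^ 2)⁻¹) •
                -(∫ ω : EuclideanSpace ℝ ι, exp (-U (ω + ψ)) • U' (ω + ψ) ∂(multivariateGaussian 0 (A * Aᵀ)))).smulRight
              (∫ ω : EuclideanSpace ℝ ι, exp (-U (ω + ψ)) • (U'' (ω + ψ) - (U' (ω + ψ)).smulRight (U' (ω + ψ))) ∂(multivariateGaussian 0 (A * Aᵀ))))
            +
            (((ContinuousLinearMap.smulRightL ℝ (EuclideanSpace ℝ ι) (EuclideanSpace ℝ ι →L[ℝ] ℝ))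
                (((∫ ω : EuclideanSpace ℝ ι, exp (-U (ω + ψ)) ∂(multivariateGaussian 0 (A * Aᵀ))) ^ 2)⁻¹ •
                  (∫ ω : EuclideanSpace ℝ ι, exp (-U (ω + ψ)) • U' (ω + ψ) ∂(multivariateGaussian 0 (A * Aᵀ))))).comp
              (∫ ω : EuclideanSpace ℝ ι, exp (-U (ω + ψ)) • (U'' (ω + ψ) - (U' (ω + ψ)).smulRight (U' (ω + ψ))) ∂(multivariateGaussian 0 (A * Aᵀ)))
              +
              (((ContinuousLinearMap.smulRightL ℝ (EuclideanSpace ℝ ι) (EuclideanSpace ℝ ι →L[ℝ] ℝ))).comp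
                (((∫ ω : EuclideanSpace ℝ ι, exp (-U (ω + ψ)) ∂(multivariateGaussian 0 (A * Aᵀ))) ^ 2)⁻¹ •
                  (∫ ω : EuclideanSpace ℝ ι, exp (-U (ω + ψ)) • (U'' (ω + ψ) - (U' (ω + ψ)).smulRight (U' (ω + ψ)))
                    ∂(multivariateGaussian 0 (A * Aᵀ))) +
                  ((-2 / (∫ ω : EuclideanSpace ℝ ι, exp (-U (ω + ψ)) ∂(multivariateGaussian 0 (A * Aᵀ))) ^ 3) •
                    -(∫ ω : EuclideanSpace ℝ ι, exp (-U (ω + ψ)) • U' (ω + ψ) ∂(multivariateGaussian 0 (A * Aᵀ)))).smulRight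
                  (∫ ω : EuclideanSpace ℝ ι, exp (-U (ω + ψ)) • U' (ω + ψ) ∂(multivariateGaussian 0 (A * Aᵀ))))).flip
              (∫ ω : EuclideanSpace ℝ ι, exp (-U (ω + ψ)) • U' (ω + ψ) ∂(multivariateGaussian 0 (A * Aᵀ))))) (EuclideanSpace.single v (1 : ℝ))
          (EuclideanSpace.single y (1 : ℝ)) (EuclideanSpace.single z (1 : ℝ))|) * (ϑc y₁ y₂ * ϑc y₁ y₃ * ϑc y₂ y₃) ≤
      |t| ^ 3 * n * M ^ 3 *
          (k3cϑ + (2 * (dθ * αg1m * (dθ' * αθc) / (1 - lamA)) + dθ * αθ * (dθ' * αg1c) / (1 - lamA)) + 4 * Real.sqrt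
            (5 * (κ₂ ^ 4 * γop ^ 2) / (1 - lam * γop) ^ 2 * (αθ * dθ * (βθ * dθ') / (1 - lamA))) * Sϑ2 ^ 2) := by
  obtain ⟨v₀⟩ : Nonempty ι := inferInstance
  have hϑ0 : ∀ a b, 0 ≤ ϑ a b := fun a b => zero_le_one.trans (hϑ1 a b)
  refine weighted_coarse_k3_letter_le_third β hfib _ (fun _ _ _ => abs_nonneg _) hM hϑ0 hϑc0 hϑc ?_
      (fun v => classmap_three_v hΓop Y hUd hU'd hU''d hU₃c hκ₀ hκ₁ ha hκ₂ hκ₃ hτ hδ hθ0 hθ1 hκθ hκθw hstab hU'b hU''b hU₃b hlam hUsec hρg hHk hHk0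
        hK3 hhr ψ hαr hαc hlamA hlamA1 hγ hγ1 hD hDC hθw1 hDr hdθ hDc hdθ' hσ0 hσθ hρ1 hρsymm hρmul hρσ hϑ1 hϑsymm hϑmul hϑ2 hϑ₂symm hϑσ hS2 hσA0
        hσϑ₂ hAr hαrσ hAc hαcσ hhrw hhc hk3r hk3c hαθ hαβ hαθc hαg1m hαg1c v) t y₁
  exact letter_nonneg₂ (fun y z => mul_nonneg (abs_nonneg _) (mul_nonneg (mul_nonneg (hϑ0 v₀ y) (hϑ0 v₀ z)) (hϑ0 y z)))
      (classmap_three_v hΓop Y hUd hU'd hU''d hU₃c hκ₀ hκ₁ ha hκ₂ hκ₃ hτ hδ hθ0 hθ1 hκθ hκθw hstab hU'b hU''b hU₃b hlam hUsec hρg hHk hHk0 hK3 hhr ψ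
        hαr hαc hlamA hlamA1 hγ hγ1 hD hDC hθw1 hDr hdθ hDc hdθ' hσ0 hσθ hρ1 hρsymm hρmul hρσ hϑ1 hϑsymm hϑmul hϑ2 hϑ₂symm hϑσ hS2 hσA0 hσϑ₂ hAr
        hαrσ hAc hαcσ hhrw hhc hk3r hk3c hαθ hαβ hαθc hαg1m hαg1c v₀)

/-! ## Toy -/

/-- Toy (one step in numbers): a letter `5` becomes at most `|t|³·n·M³·5 = 1·16·8·5 = 640` one scale up (`t = 1`, `n = 16`, `M = 2`). -/
example : |(1 : ℝ)| ^ 3 * 16 * 2 ^ 3 * 5 = 640 := by norm_num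

end Summit.QuantumFields.BalabanUV.T4Continuum.NE7b.SupWeightedClassMapOrderThreeStepRoles

end
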